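import Summits.BirchSwinnertonDyer.BirchSwinnertonDyer.Theorems.WildThreeRankOneBSDpOfJetchevMaxOfLiterature
import Summits.BirchSwinnertonDyer.BirchSwinnertonDyer.Theorems.WildThreeRankOneBSDpOfHeegnerIndexCoprime
import HarnessLib

/-!
# Single-carrier JET rows of W-ALL row 2·3@3: BOTH index sockets from named print, and `BSD₃(E) ⟺ BSD₃(E^{d_K})`
# — the rank-one wild row and the rank-zero wild row of its Heegner twist are ONE problem there
# (route-free; cell `bsd-wall`, D-0131 (3) M-UTD, seat `bsd-wall-utd-p3` gen 3; `--supports stmt-BirchSwinnertonDyer-20760`, helper)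

Sequel of `WildThreeRankOneBSDpOfJetchevMaxOfLiterature.lean` (p570933: RUNG J_max@3 ⟸ {(PT), (F1), (3.7)} over the
`bsd-jet` road-K kernel; the single-carrier class theorem ⟸ named print + leaf #6) and of gen 0's
`WildThreeRankOneBSDpOfHeegnerIndexCoprime.lean` §4 (`bsdp_iff_partner_bsdp_of_exactIndexManin`: with the index EXACT,
`BSD_p(E) ⟺ BSD_p(E^{d_K})`). Here the exactness is supplied by print on the single-carrier rows:

* `indexBounds_of_singleCarrier_of_literature` — on a JET-exact single-carrier Heegner datum of the onto wild rank-one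
  row at 3, {(PT) `poitouTate_selmerStructure_duality_conj` ∀K, (F1) `Gross1991_heegnerPoint_sub_ratTorsion_mem_E0`,
  (3.7) `GrossLMS1991.prop37_2_frobeniusCongruence`} + {Gross–Zagier, Kolyvagin, modularity} (named) give
  `Ш(E/K)[3^∞] = ⊥` and hence BOTH sockets `IndexLowerBoundLeAt ∧ Upper.IndexUpperBoundLeAt` at slack `v₃(c)` — the
  exact index that the UTD kernel (20390) draws from cruxes #2–#5, here with NO crux.
* `bsdp_iff_partner_bsdp_of_singleCarrier_of_literature` — hence `BSDp W 3 ↔ BSDp Wd 3` for any minimal model `Wd`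
  of `E^{d_K}`: leaf #6 on these twists is NECESSARY AND SUFFICIENT for the single-carrier sub-leaf.

HONEST FRAMING: conditional on the named facts (hypotheses); per datum; closes no item and no class; «beyond-print
theorem»: NO. BSD is not proved for any curve by this file. No definition, no named fact, no `sorry`.
References: [Jetchev2008] Thm. 1.4, Cor. 1.5; [McCallumLMS1991] Lemma 5.1; [GrossLMS1991] §10, Prop. 3.7 (2);
[JetchevSkinnerWan2017] §7.4.1; [GrossZagier1986] I.(6.3), I.(7.3), III (3.1).
-/

noncomputable section

open scoped Classical

set_option linter.dupNamespace false
set_option autoImplicit false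

namespace Summit.BirchSwinnertonDyer.BirchSwinnertonDyer.Theorems.SchneiderFree.Exact

open WeierstrassCurve NumberField IsDedekindDomain Field
  Literature.NumberTheory.EllipticCurves
  Literature.NumberTheory.EllipticCurves.ModularForms
  Literature.NumberTheory.EllipticCurves.Rank1Residual
  Literature.NumberTheory.EllipticCurves.KrizLi2019
  Literature.NumberTheory.GaloisCohomology
  Summit.BirchSwinnertonDyer.Rank1Residual
  Summit.BirchSwinnertonDyer.Rank1Residual.Additive
  Summit.BirchSwinnertonDyer.Rank1Residual.X11b
  Summit.BirchSwinnertonDyer.Rank1Residual.X11b.Three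
  Summit.BirchSwinnertonDyer.BirchSwinnertonDyer.Theorems.UniversalToricDescentWaldspurgerFlat

/-! ### The sockets and the EQUIVALENCE with the rank-zero wild twist on single-carrier data -/

/-- **Both index sockets at slack `v₃(c)` on a single-carrier JET-exact datum, from named print alone.** Same
binders as `bsdp_three_of_singleCarrier_of_literature_of_wAllExclAddWildRankZero` WITHOUT the leaf: {(PT), (F1),
(3.7)} + {Gross–Zagier, Kolyvagin, modularity} give `Ш(E/K)[3^∞] = ⊥` (§1 at depth `M₀ = ord₃[E(K):ℤP]` + pv-1's
divided descent), hence `ord₃ #Ш(E/K) = 0` and — by the arithmetic of `hI` — BOTH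
`SchneiderFree.IndexLowerBoundLeAt W 3 K P (v₃ c)` and `SchneiderFree.Upper.IndexUpperBoundLeAt W 3 K P (v₃ c)`
(the EXACT index at slack `v₃(c)` that the UTD kernel 20390 obtains from cruxes #2–#5). CONDITIONAL on the named
facts; per datum. [cite: Jetchev2008, Thm. 1.4, Cor. 1.5 (arXiv:math/0703431 p. 3)]
[cite: McCallumLMS1991, §5 Lemma 5.1 (p. 303)] [cite: GrossLMS1991, §10 and Prop. 3.7 (2)] -/
theorem indexBounds_of_singleCarrier_of_literature
    (hPT : ∀ (K : Type) [Field K] [NumberField K], poitouTate_selmerStructure_duality_conj K)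
    (hF1 : Gross1991_heegnerPoint_sub_ratTorsion_mem_E0)
    (h372 : GrossLMS1991.prop37_2_frobeniusCongruence)
    (hGZ : ∀ (N : ℕ) [NeZero N] (W : WeierstrassCurve ℚ) (K : Type) [Field K] [NumberField K],
      gross_zagier N W K)
    (hKo : ∀ (N : ℕ) [NeZero N] (W : WeierstrassCurve ℚ) (K : Type) [Field K] [NumberField K],
      kolyvagin N W K)
    (hmod : hasEntireLFunction_rat)
    (W : WeierstrassCurve ℚ) [W.IsElliptic] [W.IsGloballyMinimal] [NeZero (W.conductorNorm ℤ)]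
    (hO6 : ClassO6 W 3) (hρ : ∀ n : ℕ, W.HasSurjectiveModNGaloisRep (3 ^ n : ℕ)) (hr : W.analyticRank = 1)
    (K : Type) [Field K] [NumberField K]
    (Dt : ModularParametrizationData W (W.conductorNorm ℤ))
    (H : HeegnerDatum (W.conductorNorm ℤ) (NumberField.discr K)) (ι : K →+* ℂ)
    (P : (W.baseChange K).toAffine.Point)
    (hK : IsImaginaryQuadratic K) (hodd : Odd (NumberField.discr K))
    (hHH : SatisfiesHeegnerHypothesis (W.conductorNorm ℤ) K)
    (hLd : (W.quadraticTwist (NumberField.discr K : ℚ)).entireLFunction 1 ≠ 0)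
    (hP : WeierstrassCurve.Affine.Point.map ι.toRatAlgHom P = heegnerPointComplex Dt H)
    (hI : padicValNat 3 (AddSubgroup.zmultiples P).index =
      padicValNat 3 W.tamagawaProduct + padicValNat 3 Dt.c.natAbs)
    {q₀ : ℕ} [Fact q₀.Prime] (hq₀ : q₀ ∣ W.conductorNorm ℤ)
    (hcar : padicValNat 3 W.tamagawaProduct + padicValNat 3 Dt.c.natAbs ≤
      padicValNat 3 ((W.baseChange ℚ_[q₀]).localTamagawaNumber ℤ_[q₀])) :
    IndexLowerBoundLeAt W 3 K P (padicValNat 3 Dt.c.natAbs) ∧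
      Upper.IndexUpperBoundLeAt W 3 K P (padicValNat 3 Dt.c.natAbs) := by
  have hp : (3 : ℕ).Prime := by norm_num
  have hsurj : W.HasSurjectiveModNGaloisRep 3 := by simpa using hρ 1
  have htow : AdditiveThree.TowerSurjThree W := fun n _ ↦ hρ n
  have hcm : ¬ W.HasCM := JET.not_hasCM_of_tower W 3 (by decide) hρ
  have h3N : 3 ∣ W.conductorNorm ℤ :=
    (W.dvd_conductorNorm_iff_not_hasGoodReductionAtPrime 3).mpr (not_good_of_addv W 3 hO6.2.1)
  have h3 : NumberField.discr K ≠ -3 := by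
    intro h
    exact (X11b.Three.not_dvd_discr_and_not_dvd_torsionOrder_of_heegner hK hHH (by decide) h3N).1
      (h ▸ ⟨-1, by norm_num⟩)
  have h4 : NumberField.discr K ≠ -4 := by
    intro h
    rw [h] at hodd
    exact (Int.not_odd_iff_even.mpr ⟨-2, by norm_num⟩) hodd
  have hL0 : W.entireLFunction 1 = 0 := entireLFunction_one_eq_zero_of_analyticRank_eq_one hr
  obtain ⟨-, hderiv⟩ := leadingLCoeff_eq_deriv_of_analyticRank_eq_one hr
  have hLK : LDerivEK W K ≠ 0 := by
    rw [lDerivEK_eq_deriv_mul W K hmod hL0]; exact mul_ne_zero hderiv hLd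
  have hnt : ¬ IsOfFinAddOrder P :=
    (lDerivEK_ne_zero_iff_not_isOfFinAddOrder W (W.conductorNorm ℤ) K (hGZ _ W K) hK hHH
      ⟨Dt, H, ι, hP⟩).mp hLK
  obtain ⟨hrank, hfin⟩ := hKo (W.conductorNorm ℤ) W K hK hHH ⟨Dt, H, ι, hP⟩ hnt
  haveI : Finite (W.baseChange K).sha := hfin
  haveI : NeZero ((3 : ℕ) : ℚ) := ⟨by norm_num⟩
  have hirr : W.HasIrreducibleModPGaloisRep 3 := hasIrreducibleModPGaloisRep_of_hasSurjectiveModNGaloisRep W 3 hsurj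
  have hbot3 := torsionBy_eq_bot_of_isImaginaryQuadratic_of_hasIrreducibleModPGaloisRep W K hK hp hirr
  have hiv : ∀ x : (W.baseChange K).toAffine.Point, 3 • x = 0 → x = 0 := fun x hx ↦ by
    have hmem : x ∈ AddSubgroup.torsionBy (W.baseChange K).toAffine.Point ((3 : ℕ) : ℤ) := by
      rw [mem_torsionBy_iff, natCast_zsmul]
      exact hx
    rw [hbot3] at hmem
    exact hmem
  haveI : Module.Finite ℤ (W.baseChange K).toAffine.Point := (W.baseChange K).module_finite_point_holds
  obtain ⟨M₀, x₀, hx₀, hmax⟩ := exists_pow_smul_eq_and_forall_ne hnt (p := 3) hp.two_le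
  have hdiv : ∃ Q : (W.baseChange K).toAffine.Point, ((3 ^ M₀ : ℕ) : ℤ) • Q = P :=
    ⟨x₀, by rw [natCast_zsmul]; exact hx₀⟩
  have hndiv : ¬ ∃ Q : (W.baseChange K).toAffine.Point, ((3 ^ (M₀ + 1) : ℕ) : ℤ) • Q = P := by
    rintro ⟨Q, hQ⟩
    exact hmax Q (by rw [← natCast_zsmul]; exact hQ)
  haveI : Finite (AddCommGroup.torsion (W.baseChange K).toAffine.Point) :=
    WeierstrassCurve.finite_torsion_point (W := W.baseChange K)
  obtain ⟨c, Q, hcQ, hcker⟩ := RankOne.exists_coord_of_mordellWeilRank_eq_one (W.baseChange K) hrank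
  have hidx : padicValNat 3 (AddSubgroup.zmultiples P).index = M₀ :=
    Koly.padicValNat_index_zmultiples_eq_of_divisibility c Q hcQ hcker hiv P hdiv hndiv
  have hM₀ : M₀ ≤ padicValNat 3 ((W.baseChange ℚ_[q₀]).localTamagawaNumber ℤ_[q₀]) := by
    rw [← hidx, hI]; exact hcar
  obtain ⟨d₁⟩ := exists_kolyvaginHeegnerData_one
    (phi_heegnerTau_mem_singularModuliField_holds (W.conductorNorm ℤ) W K) hK Dt H.β ι H.dvd_sq_sub
  have hPd : d₁.toGeomPoints d₁.derivedPoint = toGeomPoints (W.baseChange K) P :=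
    KolyvaginBottom.toGeomPoints_derivedPoint_one_eq
      (heegnerPointOfConductor_one_galoisConj_holds (W.conductorNorm ℤ) W K) hK hHH hP d₁ rfl
  have hGD : ∀ (n : ℕ) (d : KolyvaginHeegnerData Dt H.β ι n), Squarefree n →
      (∀ ℓ ∈ n.primeFactors, Zhang2014.IsKolyvaginPrime (W.conductorNorm ℤ) W K 3 ℓ ∧
        M₀ ≤ Zhang2014.kolyvaginIndex W 3 ℓ) →
      ∃ Q : (W.baseChange (ringClassField K ι n)).toAffine.Point, ((3 ^ M₀ : ℕ) : ℤ) • Q = d.derivedPoint :=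
    fun n d hn hℓ ↦ jetchevMaxAtThree_of_literature hPT hF1 h372 W (W.conductorNorm ℤ) K Dt H ι P hO6 hsurj
      hr rfl hK hHH hLd hP hnt hodd h3 htow q₀ hq₀ M₀ hM₀ n d hn hℓ
  haveI : NumberField.IsTotallyComplex K := hK.isTotallyComplex
  have hsha : AddCommGroup.primaryComponent (W.baseChange K).sha 3 = ⊥ :=
    JET.DividedDescent.sha_primary_eq_bot_of_globalDivisibility W hcm K hK h3 h4 hHH 3 (by decide) hρ Dt H.β ι
      d₁ P hPd ⟨Dt, H, ι, hP⟩ hnt M₀ hndiv hGD (poitouTate_sum_localTatePairing_eq_zero_of_isTotallyComplex K)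
      (JET.prop44_of_frobeniusCongruence h372) hF1
  have hsha0 : padicValNat 3 (W.baseChange K).shaOrder = 0 := by
    rw [Koly.padicValNat_shaOrder_eq (W.baseChange K) 3, hsha, AddSubgroup.card_bot, padicValNat_one_right]
  refine ⟨?_, ?_⟩
  · unfold IndexLowerBoundLeAt; omega
  · unfold Upper.IndexUpperBoundLeAt; omega

/-- **On single-carrier JET-exact data, `BSD₃(E) ⟺ BSD₃(E^{d_K})` from named print alone** — the rank-ONE wild
row of W-ALL at 3 and the rank-ZERO wild row of its Heegner twist are ONE problem there (gen 0 §4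
`bsdp_iff_partner_bsdp_of_exactIndexManin` fed with §3's sockets; `Wd` any globally minimal model of `E^{d_K}`).
So leaf #6 `WAllExclAddWildRankZero` restricted to these twists is NECESSARY AND SUFFICIENT for the single-carrier
sub-leaf — no anticyclotomic main conjecture, no `p`-adic `L`-function, no twin, no McCallum, no research input on
the Kolyvagin side. CONDITIONAL on {(PT), (F1), (3.7)} + {GZ, Kolyvagin, GZK, modularity, GZ86 I.(7.3)}; per datum.
[cite: JetchevSkinnerWan2017, §7.4.1 (arXiv:1512.06894 p. 30)] [cite: GrossZagier1986, Thm. I.(6.3) and (7.3)]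
[cite: Jetchev2008, Thm. 1.4, Cor. 1.5 (arXiv:math/0703431 p. 3)] -/
theorem bsdp_iff_partner_bsdp_of_singleCarrier_of_literature
    (hPT : ∀ (K : Type) [Field K] [NumberField K], poitouTate_selmerStructure_duality_conj K)
    (hF1 : Gross1991_heegnerPoint_sub_ratTorsion_mem_E0)
    (h372 : GrossLMS1991.prop37_2_frobeniusCongruence)
    (hGZ : ∀ (N : ℕ) [NeZero N] (W : WeierstrassCurve ℚ) (K : Type) [Field K] [NumberField K],
      gross_zagier N W K)
    (hKo : ∀ (N : ℕ) [NeZero N] (W : WeierstrassCurve ℚ) (K : Type) [Field K] [NumberField K],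
      kolyvagin N W K)
    (hGZK : rank_eq_analyticRank_of_analyticRank_le_one) (hmod : hasEntireLFunction_rat)
    (hGZ73 : GrossZagier1986_thm_I_7_3)
    (W : WeierstrassCurve ℚ) [W.IsElliptic] [W.IsGloballyMinimal] [NeZero (W.conductorNorm ℤ)]
    (hO6 : ClassO6 W 3) (hρ : ∀ n : ℕ, W.HasSurjectiveModNGaloisRep (3 ^ n : ℕ)) (hr : W.analyticRank = 1)
    (K : Type) [Field K] [NumberField K]
    (Dt : ModularParametrizationData W (W.conductorNorm ℤ))
    (H : HeegnerDatum (W.conductorNorm ℤ) (NumberField.discr K)) (ι : K →+* ℂ)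
    (P : (W.baseChange K).toAffine.Point) (Wd : WeierstrassCurve ℚ) [Wd.IsElliptic] [Wd.IsGloballyMinimal]
    (hK : IsImaginaryQuadratic K) (hodd : Odd (NumberField.discr K))
    (hHH : SatisfiesHeegnerHypothesis (W.conductorNorm ℤ) K)
    (hLd : (W.quadraticTwist (NumberField.discr K : ℚ)).entireLFunction 1 ≠ 0)
    (hP : WeierstrassCurve.Affine.Point.map ι.toRatAlgHom P = heegnerPointComplex Dt H)
    (hC : ∃ C : VariableChange ℚ, C • W.quadraticTwist (NumberField.discr K : ℚ) = Wd)
    (hI : padicValNat 3 (AddSubgroup.zmultiples P).index =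
      padicValNat 3 W.tamagawaProduct + padicValNat 3 Dt.c.natAbs)
    {q₀ : ℕ} [Fact q₀.Prime] (hq₀ : q₀ ∣ W.conductorNorm ℤ)
    (hcar : padicValNat 3 W.tamagawaProduct + padicValNat 3 Dt.c.natAbs ≤
      padicValNat 3 ((W.baseChange ℚ_[q₀]).localTamagawaNumber ℤ_[q₀])) :
    BSDp W 3 ↔ BSDp Wd 3 := by
  have h3N : 3 ∣ W.conductorNorm ℤ :=
    (W.dvd_conductorNorm_iff_not_hasGoodReductionAtPrime 3).mpr (not_good_of_addv W 3 hO6.2.1)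
  have hw : ¬ 3 ∣ Units.torsionOrder K :=
    (X11b.Three.not_dvd_discr_and_not_dvd_torsionOrder_of_heegner hK hHH (by decide) h3N).2
  obtain ⟨hlo, hup⟩ := indexBounds_of_singleCarrier_of_literature hPT hF1 h372 hGZ hKo hmod W hO6 hρ hr K Dt H ι
    P hK hodd hHH hLd hP hI hq₀ hcar
  exact bsdp_iff_partner_bsdp_of_exactIndexManin hGZ hKo hGZK hmod hGZ73 W 3 (W.conductorNorm ℤ) K Dt H ι P Wd hr
    rfl h3N hK hodd hw hHH hLd hP hC (by decide) hlo hup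

end Summit.BirchSwinnertonDyer.BirchSwinnertonDyer.Theorems.SchneiderFree.Exact

end
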